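import Summits.HodgeConjecture.CorCM.TwoSexticFieldsRotationTransfer
import Summits.HodgeConjecture.CorCM.TwoSexticFieldsPowersHodgeOfMarkman
import HarnessLib

/-!
# COR-CM — TWO sextic CM fields sharing `k` (Galois or not): the Hodge conjecture for ALL products of copies of
# `E`, `B₁`, `B₂` modulo Markman, from jointly realised ROTATIONS (assembly, frame form)

Cell `pub-hodgecm2` (COR-CM), seat b30 gen 16 (2026-08-21); COUNT-NEUTRAL; theorems only, no definition, no named fact,
no `sorry`.  The rotations twin of `CorCM/TwoSexticFieldsPowersHodgeOfMarkman.lean`: the same assembly (parts lemma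
`exists_weightClassesAlg_le_algebraicClasses_of_part₂` via the distribution lemma, Pohlmann + `modelBalanced_induction`,
generators `weil4` / `pair6` modulo Markman) but the transfer to the 14-point model is
`modelBalanced_of_isGaloisBalancedAlg_rot` (`CorCM/TwoSexticFieldsRotationTransfer.lean`), whose Galois input `he_rot`
— every pair of rotations of the two frames realised by one automorphism of `ℂ` — holds for ANY two non-isomorphic
sextic CM fields sharing `k` (`CorCM/TwoSexticFieldsJointRotations.lean`), cyclic Galois ones included.

* §1 `hodgeConjectureFor_biproduct_comp_of_generators_rot`;
* §2 **`hodgeConjectureFor_biproduct_comp_of_rotFrames_of_markman`** — `HodgeConjectureFor (⨁_j A₃ (κ j))` for every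
  slot map `κ`, GIVEN ONLY `Markman2025_weilClasses_algebraic_abelianFourfold` (rotations frame form), with the
  `AVDominatedBy`, «isogenous to a product of copies» and «all powers» corollaries
  [cite: Markman2025SurveySecant, Thm. 1.2] [cite: Pohlmann1968, Thm 1] [cite: GaoUllmo2025, Thm 3.1].
The intrinsic form is `CorCM/TwoSexticFieldsSharedQuadraticHodgeOfMarkman.lean`.  HONEST FRAMING: conditional on
Markman only; `HC_CM` is not asserted; wording of record untouched.

## References
* [Markman2025SurveySecant] E. Markman, arXiv:2509.23403, Thm. 1.2.  [Pohlmann1968] Ann. of Math. 88, Thm 1.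
  [GaoUllmo2025] J. Inst. Math. Jussieu 25, Thm 3.1.  [Milne2020HodgeClassesAV] arXiv:2010.08857, 1.2 (a), Thm. 1.
  [MoonenZarhin1999LowDim] Duke 98 (1999), Thm. 0.1.  [MumfordAV1970] §19.  [Gordon1999HodgeAVSurvey] 7.6.1.
-/

noncomputable section

open CategoryTheory CategoryTheory.Limits NumberField

namespace Summit.HodgeConjecture.CorCM.TwoSexticFields

open Literature.AlgebraicGeometry Literature.AlgebraicGeometry.Motives Literature.AlgebraicGeometry.HodgeTheory
open Literature.AlgebraicGeometry.ComplexMultiplication (IsCMTypeRealisation)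
open Literature.AlgebraicGeometry.Pohlmann1968
open Summit.HodgeConjecture.CorCM.Census.DihedralSexticPairCurve (Pt' act' phi' conjPair weil4 pair6 gens mem_gens_iff
  gens_balanced)
open Summit.HodgeConjecture.CorCM.Census.DihedralSexticPairCurvePowers (ModelBalanced modelBalanced_induction)
open Summit.HodgeConjecture.CorCM.DihedralSexticPair (eq_or_eq_conjugate)
open Summit.HodgeConjecture.CorCM.PairWeights (weightClassesAlg_union_le_algebraicClasses)
open Summit.HodgeConjecture.CorCM.CMWeights (weightClassesAlg_comp_le_algebraicClasses_of_injOn)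

open scoped Classical

/-! ## §1 Assembly from the generator hypotheses, rotations form -/

section Assembly

variable {I : Type} {Kf : I → Type} [∀ i, Field (Kf i)] [∀ i, NumberField (Kf i)] [∀ i, IsCMField (Kf i)]
  {i₀ : I} {tl : Fin 2 → I} {N : ℕ} (κ : Fin N → Fin 3) {e : ∀ m : Fin 2, (Kf (tl m) →+* ℂ) ≃ ZMod 3 × Bool}
  {τ : Kf i₀ →+* ℂ} {i : ∀ m : Fin 2, Kf i₀ →+* Kf (tl m)}
  {A₃ : Fin 3 → AbelianVariety ℂ} {Φ₃ : ∀ m : Fin 3, CMType (Kf (slots i₀ tl m))}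
  {ι₃ : ∀ m, 𝓞 (Kf (slots i₀ tl m)) →+* End (A₃ m)}
  {θ₃ : ∀ m, Kf (slots i₀ tl m) →+* Module.End ℂ (complexBetti (A₃ m).X 1)}

/-- **`HodgeConjectureFor (⨁_j A₃ (κ j))` from the two frames, jointly realised ROTATIONS and the two generator
hypotheses on `Y = E × B₁ × B₂`** (any slot map `κ`): every rational `(p,p)`-class of the power is algebraic.  Pohlmann's
theorem for the CM algebra `∏_j K_{κ j}`, the two-frame transfer, the induction principle for balanced configurations of
the 14-point model, §1, and the multiplicativity of algebraic weight lines.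
[cite: Pohlmann1968, Thm 1] [cite: GaoUllmo2025, Thm 3.1] [cite: Milne2020HodgeClassesAV, 1.2 (a) and Thm. 1] -/
theorem hodgeConjectureFor_biproduct_comp_of_generators_rot
    (hττ : ComplexEmbedding.conjugate τ ≠ τ) (hk : ∀ σ : Kf i₀ →+* ℂ, σ = τ ∨ σ = ComplexEmbedding.conjugate τ)
    (hA : ∀ m, IsCMTypeRealisation (Φ₃ m) (A₃ m) (ι₃ m) (θ₃ m))
    (he_conj : ∀ (m : Fin 2) (s : Kf (tl m) →+* ℂ), e m (ComplexEmbedding.conjugate s) = ((e m s).1, !(e m s).2))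
    (he_sign : ∀ (m : Fin 2) (s : Kf (tl m) →+* ℂ), s.comp (i m) = τ ↔ (e m s).2 = true)
    (he_rot : ∀ js : Fin 2 → ZMod 3, ∃ σ : ℂ ≃+* ℂ, ∀ (m : Fin 2) (s : Kf (tl m) →+* ℂ),
      e m ((σ : ℂ →+* ℂ).comp s) = ((e m s).1 + js m, (e m s).2))
    (hΨ : ∀ σ : Kf i₀ →+* ℂ, σ ∈ (Φ₃ 0).1 ↔ σ = τ)
    (hΦ : ∀ (m : Fin 2) (s : Kf (tl m) →+* ℂ), s ∈ (Φ₃ m.succ).1 ↔ (e m s).2 = decide ((e m s).1.val = m.val))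
    (hweil4 : ∀ (m : Fin 2) (b : Bool) (T : Finset ((m : Fin 3) × (Kf (slots i₀ tl m) →+* ℂ))),
      T.image (toPt₂ e τ) = weil4 m b → weightClassesAlg A₃ ι₃ (2 * 2) T ≤ algebraicClasses (⨁ A₃).X 2)
    (hpair6 : ∀ (b : Bool) (T : Finset ((m : Fin 3) × (Kf (slots i₀ tl m) →+* ℂ))),
      T.image (toPt₂ e τ) = pair6 b → weightClassesAlg A₃ ι₃ (2 * 3) T ≤ algebraicClasses (⨁ A₃).X 3) :
    HodgeConjectureFor (⨁ fun j => A₃ (κ j)).dim (⨁ fun j => A₃ (κ j)).X := by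
  refine ⟨nonempty_hodgeModel_holds (Motives.AbelianVariety.isSmoothProjective_holds (A := ⨁ fun j => A₃ (κ j))),
    fun p c hc hH => ?_⟩
  have hAκ : ∀ j, IsCMTypeRealisation (Φ₃ (κ j)) (A₃ (κ j)) (ι₃ (κ j)) (θ₃ (κ j)) := fun j => hA (κ j)
  -- every balanced configuration has algebraic weight lines: induct over its generating parts
  have key : ∀ (R : Finset ((j : Fin N) × (Kf (slots i₀ tl (κ j)) →+* ℂ))),
      ModelBalanced (fun x => toPt₂ e τ ((Sigma.map κ (fun _ => id) :
        ((j : Fin N) × (Kf (slots i₀ tl (κ j)) →+* ℂ)) → ((m : Fin 3) × (Kf (slots i₀ tl m) →+* ℂ))) x)) R →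
      ∀ q, R.card = 2 * q → weightClassesAlg (fun j => A₃ (κ j)) (fun j => ι₃ (κ j)) (2 * q) R ≤
        algebraicClasses (⨁ fun j => A₃ (κ j)).X q := by
    intro R hR
    refine modelBalanced_induction (motive := fun R => ∀ q, R.card = 2 * q →
      weightClassesAlg (fun j => A₃ (κ j)) (fun j => ι₃ (κ j)) (2 * q) R ≤ algebraicClasses (⨁ fun j => A₃ (κ j)).X q)
      (fun q hq => ?_) (fun G R hGR hinj hG ih q hq => ?_) hR
    · obtain rfl : q = 0 := by simpa using hq.symm
      exact fun c _ => hodgeConjectureFor_codim_zero c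
    · obtain ⟨a, ha, hGalg⟩ :=
        exists_weightClassesAlg_le_algebraicClasses_of_part₂ κ hττ hk he_conj hA hweil4 hpair6 hinj hG
      have hRcard : R.card = 2 * (q - a) := by
        have h := Finset.card_union_of_disjoint hGR
        rw [hq, ha] at h
        omega
      have haq : a + (q - a) = q := by
        have h := Finset.card_union_of_disjoint hGR
        rw [hq, ha] at h
        omega
      rw [← Finset.disjUnion_eq_union G R hGR]
      exact weightClassesAlg_union_le_algebraicClasses hAκ haq ha hRcard hGR hGalg (ih (q - a) hRcard)
  have hmem : c ∈ ⨆ S ∈ pohlmannSetsAlg (K := fun j => Kf (slots i₀ tl (κ j))) (fun j => Φ₃ (κ j)) p,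
      weightClassesAlg (fun j => A₃ (κ j)) (fun j => ι₃ (κ j)) (2 * p) S := by
    rw [← (Pohlmann1968_thm1_cmAlgebra (fun j => Kf (slots i₀ tl (κ j))) (fun j => A₃ (κ j))
      (fun j => Φ₃ (κ j)) (fun j => ι₃ (κ j)) (fun j => θ₃ (κ j)) hAκ p).1]
    exact Submodule.subset_span ⟨hc, hH⟩
  have hle : (⨆ S ∈ pohlmannSetsAlg (K := fun j => Kf (slots i₀ tl (κ j))) (fun j => Φ₃ (κ j)) p,
      weightClassesAlg (fun j => A₃ (κ j)) (fun j => ι₃ (κ j)) (2 * p) S) ≤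
      algebraicClasses (⨁ fun j => A₃ (κ j)).X p := by
    refine iSup₂_le fun S hS => ?_
    exact key S (modelBalanced_of_isGaloisBalancedAlg_rot hττ hk he_sign he_conj he_rot hΨ hΦ κ hS.2) p hS.1
  exact hle hmem

end Assembly

/-! ## §2 The rotations frame form modulo Markman, and its corollaries -/

section Markman

variable {I : Type} {Kf : I → Type} [∀ i, Field (Kf i)] [∀ i, NumberField (Kf i)] [∀ i, IsCMField (Kf i)]
  {i₀ : I} {tl : Fin 2 → I} {τ : Kf i₀ →+* ℂ}
  {A₃ : Fin 3 → AbelianVariety ℂ} {Φ₃ : ∀ m : Fin 3, CMType (Kf (slots i₀ tl m))}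
  {ι₃ : ∀ m, 𝓞 (Kf (slots i₀ tl m)) →+* End (A₃ m)}
  {θ₃ : ∀ m, Kf (slots i₀ tl m) →+* Module.End ℂ (complexBetti (A₃ m).X 1)}

/-- **MAIN THEOREM (rotations frame form, two fields — Galois or not).  The Hodge conjecture for every product of copies of `E`, `B₁`, `B₂` —
`⨁_j A₃(κ j)`, i.e. `E^c × B₁^a × B₂^b` for all `a, b, c`, in any order — modulo Markman's fourfold theorem.**
`k = Kf i₀` imaginary quadratic with `τ(δ) = i√d`; TWO sextic fields `K_m = Kf (tl m) ⊇ i_m(k)` (`m = 0, 1`) read in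
frames `e m` (conjugation flips the sign, sign `true` iff `s ∘ i_m = τ`) with the JOINT ROTATIONS hypothesis `he_rot`
(each pair of rotations `(p ↦ p + j₀, p ↦ p + j₁)` realised on `Hom(K₁, ℂ)`, `Hom(K₂, ℂ)` by one automorphism of `ℂ`);
`A₃ 0 ⊨ (k; {τ})`, `A₃ (m+1) ⊨ (K_m; Φ_m)` with `Φ_m` of sign `true` exactly over the place `m`.  Then every rational
`(p,p)`-class on `⨁_j A₃ (κ j)` is algebraic, for every slot map `κ : Fin N → Fin 3` and every `p`, GIVEN ONLY
`Markman2025_weilClasses_algebraic_abelianFourfold`. [cite: Markman2025SurveySecant, Thm. 1.2 and §11.5 Step 2]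
[cite: Pohlmann1968, Thm 1] [cite: GaoUllmo2025, Thm 3.1] [cite: Milne2020HodgeClassesAV, Thm. 1]
[cite: MoonenZarhin1999LowDim, Thm. 0.1] -/
theorem hodgeConjectureFor_biproduct_comp_of_rotFrames_of_markman {N : ℕ} (κ : Fin N → Fin 3)
    (hW4 : Markman2025_weilClasses_algebraic_abelianFourfold)
    (h6 : ∀ m : Fin 2, Module.finrank ℚ (Kf (tl m)) = 6) (h2 : Module.finrank ℚ (Kf i₀) = 2)
    (i : ∀ m : Fin 2, Kf i₀ →+* Kf (tl m))
    {δ : 𝓞 (Kf i₀)} {d : ℕ} (hd : 0 < d) (hδ : ((δ : Kf i₀)) ^ 2 = -(d : Kf i₀))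
    (hτ : τ (δ : Kf i₀) = Complex.I * (Real.sqrt d : ℂ))
    (hA : ∀ m, IsCMTypeRealisation (Φ₃ m) (A₃ m) (ι₃ m) (θ₃ m))
    (e : ∀ m : Fin 2, (Kf (tl m) →+* ℂ) ≃ ZMod 3 × Bool)
    (he_conj : ∀ (m : Fin 2) (s : Kf (tl m) →+* ℂ), e m (ComplexEmbedding.conjugate s) = ((e m s).1, !(e m s).2))
    (he_sign : ∀ (m : Fin 2) (s : Kf (tl m) →+* ℂ), s.comp (i m) = τ ↔ (e m s).2 = true)
    (he_rot : ∀ js : Fin 2 → ZMod 3, ∃ σ : ℂ ≃+* ℂ, ∀ (m : Fin 2) (s : Kf (tl m) →+* ℂ),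
      e m ((σ : ℂ →+* ℂ).comp s) = ((e m s).1 + js m, (e m s).2))
    (hΨ : ∀ σ : Kf i₀ →+* ℂ, σ ∈ (Φ₃ 0).1 ↔ σ = τ)
    (hΦ : ∀ (m : Fin 2) (s : Kf (tl m) →+* ℂ), s ∈ (Φ₃ m.succ).1 ↔ (e m s).2 = decide ((e m s).1.val = m.val)) :
    HodgeConjectureFor (⨁ fun j => A₃ (κ j)).dim (⨁ fun j => A₃ (κ j)).X :=
  hodgeConjectureFor_biproduct_comp_of_generators_rot κ (CMThreefoldPair.conjugate_ne_of_apply_eq hd hτ)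
    (fun σ => eq_or_eq_conjugate h2 hd hτ σ) hA he_conj he_sign he_rot hΨ hΦ
    (fun m b T hT => weightClassesAlg_le_algebraicClasses_of_image_eq_weil4₂ hW4 h6 h2 hd hδ hτ hA he_sign hΨ hΦ m b T hT)
    (fun b T hT => weightClassesAlg_le_algebraicClasses_of_image_eq_pair6₂ hW4 h6 h2 hd hδ hτ hA he_sign hΦ b T hT)

/-- **The one-copy case `κ = id`: the Hodge conjecture for `E × B₁ × B₂ = ⨁ A₃` itself** (frame form, modulo Markman).
[cite: Markman2025SurveySecant, Thm. 1.2] [cite: Pohlmann1968, Thm 1] -/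
theorem hodgeConjectureFor_biproduct_of_rotFrames_of_markman
    (hW4 : Markman2025_weilClasses_algebraic_abelianFourfold)
    (h6 : ∀ m : Fin 2, Module.finrank ℚ (Kf (tl m)) = 6) (h2 : Module.finrank ℚ (Kf i₀) = 2)
    (i : ∀ m : Fin 2, Kf i₀ →+* Kf (tl m))
    {δ : 𝓞 (Kf i₀)} {d : ℕ} (hd : 0 < d) (hδ : ((δ : Kf i₀)) ^ 2 = -(d : Kf i₀))
    (hτ : τ (δ : Kf i₀) = Complex.I * (Real.sqrt d : ℂ))
    (hA : ∀ m, IsCMTypeRealisation (Φ₃ m) (A₃ m) (ι₃ m) (θ₃ m))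
    (e : ∀ m : Fin 2, (Kf (tl m) →+* ℂ) ≃ ZMod 3 × Bool)
    (he_conj : ∀ (m : Fin 2) (s : Kf (tl m) →+* ℂ), e m (ComplexEmbedding.conjugate s) = ((e m s).1, !(e m s).2))
    (he_sign : ∀ (m : Fin 2) (s : Kf (tl m) →+* ℂ), s.comp (i m) = τ ↔ (e m s).2 = true)
    (he_rot : ∀ js : Fin 2 → ZMod 3, ∃ σ : ℂ ≃+* ℂ, ∀ (m : Fin 2) (s : Kf (tl m) →+* ℂ),
      e m ((σ : ℂ →+* ℂ).comp s) = ((e m s).1 + js m, (e m s).2))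
    (hΨ : ∀ σ : Kf i₀ →+* ℂ, σ ∈ (Φ₃ 0).1 ↔ σ = τ)
    (hΦ : ∀ (m : Fin 2) (s : Kf (tl m) →+* ℂ), s ∈ (Φ₃ m.succ).1 ↔ (e m s).2 = decide ((e m s).1.val = m.val)) :
    HodgeConjectureFor (⨁ A₃).dim (⨁ A₃).X :=
  hodgeConjectureFor_biproduct_comp_of_rotFrames_of_markman (id : Fin 3 → Fin 3) hW4 h6 h2 i hd hδ hτ hA e he_conj he_sign
    he_rot hΨ hΦ

/-- **Every abelian variety dominated by a power `⨁_j A₃(κ j)`** (frame form, modulo Markman): abelian subvarieties,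
quotients, isogeny factors of the products of copies of `E`, `B₁`, `B₂`. [cite: Markman2025SurveySecant, Thm. 1.2]
[cite: MumfordAV1970, §19] -/
theorem hodgeConjectureFor_of_avDominatedBy_comp_of_rotFrames_of_markman {N : ℕ} (κ : Fin N → Fin 3)
    (hW4 : Markman2025_weilClasses_algebraic_abelianFourfold)
    (h6 : ∀ m : Fin 2, Module.finrank ℚ (Kf (tl m)) = 6) (h2 : Module.finrank ℚ (Kf i₀) = 2)
    (i : ∀ m : Fin 2, Kf i₀ →+* Kf (tl m))
    {δ : 𝓞 (Kf i₀)} {d : ℕ} (hd : 0 < d) (hδ : ((δ : Kf i₀)) ^ 2 = -(d : Kf i₀))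
    (hτ : τ (δ : Kf i₀) = Complex.I * (Real.sqrt d : ℂ))
    (hA : ∀ m, IsCMTypeRealisation (Φ₃ m) (A₃ m) (ι₃ m) (θ₃ m))
    (e : ∀ m : Fin 2, (Kf (tl m) →+* ℂ) ≃ ZMod 3 × Bool)
    (he_conj : ∀ (m : Fin 2) (s : Kf (tl m) →+* ℂ), e m (ComplexEmbedding.conjugate s) = ((e m s).1, !(e m s).2))
    (he_sign : ∀ (m : Fin 2) (s : Kf (tl m) →+* ℂ), s.comp (i m) = τ ↔ (e m s).2 = true)
    (he_rot : ∀ js : Fin 2 → ZMod 3, ∃ σ : ℂ ≃+* ℂ, ∀ (m : Fin 2) (s : Kf (tl m) →+* ℂ),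
      e m ((σ : ℂ →+* ℂ).comp s) = ((e m s).1 + js m, (e m s).2))
    (hΨ : ∀ σ : Kf i₀ →+* ℂ, σ ∈ (Φ₃ 0).1 ↔ σ = τ)
    (hΦ : ∀ (m : Fin 2) (s : Kf (tl m) →+* ℂ), s ∈ (Φ₃ m.succ).1 ↔ (e m s).2 = decide ((e m s).1.val = m.val))
    {B : AbelianVariety ℂ} (hB : Domination.AVDominatedBy B (⨁ fun j => A₃ (κ j))) :
    HodgeConjectureFor B.dim B.X :=
  Domination.hodgeConjectureFor_of_avDominatedBy
    (hodgeConjectureFor_biproduct_comp_of_rotFrames_of_markman κ hW4 h6 h2 i hd hδ hτ hA e he_conj he_sign he_rot hΨ hΦ) hB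

/-- **Every abelian variety isogenous to SOME product of copies of `E`, `B₁`, `B₂`** (indexed by any finite type `J`,
classes `cls : J → Fin 3`) satisfies the Hodge conjecture (frame form, modulo Markman): re-index by `Fin N`
(`biproduct.reindex`) and apply the main theorem. [cite: Markman2025SurveySecant, Thm. 1.2] [cite: MumfordAV1970, §19] -/
theorem hodgeConjectureFor_of_isIsogenous_biproduct_comp_of_rotFrames_of_markman
    (hW4 : Markman2025_weilClasses_algebraic_abelianFourfold)
    (h6 : ∀ m : Fin 2, Module.finrank ℚ (Kf (tl m)) = 6) (h2 : Module.finrank ℚ (Kf i₀) = 2)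
    (i : ∀ m : Fin 2, Kf i₀ →+* Kf (tl m))
    {δ : 𝓞 (Kf i₀)} {d : ℕ} (hd : 0 < d) (hδ : ((δ : Kf i₀)) ^ 2 = -(d : Kf i₀))
    (hτ : τ (δ : Kf i₀) = Complex.I * (Real.sqrt d : ℂ))
    (hA : ∀ m, IsCMTypeRealisation (Φ₃ m) (A₃ m) (ι₃ m) (θ₃ m))
    (e : ∀ m : Fin 2, (Kf (tl m) →+* ℂ) ≃ ZMod 3 × Bool)
    (he_conj : ∀ (m : Fin 2) (s : Kf (tl m) →+* ℂ), e m (ComplexEmbedding.conjugate s) = ((e m s).1, !(e m s).2))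
    (he_sign : ∀ (m : Fin 2) (s : Kf (tl m) →+* ℂ), s.comp (i m) = τ ↔ (e m s).2 = true)
    (he_rot : ∀ js : Fin 2 → ZMod 3, ∃ σ : ℂ ≃+* ℂ, ∀ (m : Fin 2) (s : Kf (tl m) →+* ℂ),
      e m ((σ : ℂ →+* ℂ).comp s) = ((e m s).1 + js m, (e m s).2))
    (hΨ : ∀ σ : Kf i₀ →+* ℂ, σ ∈ (Φ₃ 0).1 ↔ σ = τ)
    (hΦ : ∀ (m : Fin 2) (s : Kf (tl m) →+* ℂ), s ∈ (Φ₃ m.succ).1 ↔ (e m s).2 = decide ((e m s).1.val = m.val))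
    {J : Type} [Fintype J] (cls : J → Fin 3) {X : AbelianVariety ℂ}
    (hX : AbelianVariety.IsIsogenous X (⨁ fun j => A₃ (cls j))) :
    HodgeConjectureFor X.dim X.X := by
  classical
  let ε : Fin (Fintype.card J) ≃ J := (Fintype.equivFin J).symm
  have eJ : (⨁ fun j => A₃ (cls j)) ≅ ⨁ fun l => A₃ (cls (ε l)) := (biproduct.reindex ε fun j => A₃ (cls j)).symm
  exact hodgeConjectureFor_of_avDominatedBy_comp_of_rotFrames_of_markman (fun l => cls (ε l)) hW4 h6 h2 i hd hδ hτ hA e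
    he_conj he_sign he_rot hΨ hΦ
    (Domination.AVDominatedBy.of_isIsogenous hX ((Domination.AVDominatedBy.refl _).of_iso_right eJ))

/-- **… and ALL POWERS of such an abelian variety**: if `X ∼ ⨁_{j : J} A₃ (cls j)` then `HodgeConjectureFor (X^{N+1})`
for every `N` (every power is an isogeny factor of a product of copies, the tree's
`exists_avDominatedBy_powSucc_biproduct_slots_of_isIsogenous`), frame form, modulo Markman.
[cite: Markman2025SurveySecant, Thm. 1.2] [cite: Gordon1999HodgeAVSurvey, 7.6.1] [cite: MumfordAV1970, §19] -/
theorem hodgeConjectureFor_powSucc_of_isIsogenous_biproduct_comp_of_rotFrames_of_markman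
    (hW4 : Markman2025_weilClasses_algebraic_abelianFourfold)
    (h6 : ∀ m : Fin 2, Module.finrank ℚ (Kf (tl m)) = 6) (h2 : Module.finrank ℚ (Kf i₀) = 2)
    (i : ∀ m : Fin 2, Kf i₀ →+* Kf (tl m))
    {δ : 𝓞 (Kf i₀)} {d : ℕ} (hd : 0 < d) (hδ : ((δ : Kf i₀)) ^ 2 = -(d : Kf i₀))
    (hτ : τ (δ : Kf i₀) = Complex.I * (Real.sqrt d : ℂ))
    (hA : ∀ m, IsCMTypeRealisation (Φ₃ m) (A₃ m) (ι₃ m) (θ₃ m))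
    (e : ∀ m : Fin 2, (Kf (tl m) →+* ℂ) ≃ ZMod 3 × Bool)
    (he_conj : ∀ (m : Fin 2) (s : Kf (tl m) →+* ℂ), e m (ComplexEmbedding.conjugate s) = ((e m s).1, !(e m s).2))
    (he_sign : ∀ (m : Fin 2) (s : Kf (tl m) →+* ℂ), s.comp (i m) = τ ↔ (e m s).2 = true)
    (he_rot : ∀ js : Fin 2 → ZMod 3, ∃ σ : ℂ ≃+* ℂ, ∀ (m : Fin 2) (s : Kf (tl m) →+* ℂ),
      e m ((σ : ℂ →+* ℂ).comp s) = ((e m s).1 + js m, (e m s).2))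
    (hΨ : ∀ σ : Kf i₀ →+* ℂ, σ ∈ (Φ₃ 0).1 ↔ σ = τ)
    (hΦ : ∀ (m : Fin 2) (s : Kf (tl m) →+* ℂ), s ∈ (Φ₃ m.succ).1 ↔ (e m s).2 = decide ((e m s).1.val = m.val))
    {J : Type} [Fintype J] (cls : J → Fin 3) {X : AbelianVariety ℂ}
    (hX : AbelianVariety.IsIsogenous X (⨁ fun j => A₃ (cls j))) (N : ℕ) :
    HodgeConjectureFor (X.powSucc N).dim (X.powSucc N).X := by
  obtain ⟨n, ρ, hdom⟩ := exists_avDominatedBy_powSucc_biproduct_slots_of_isIsogenous hX N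
  exact hodgeConjectureFor_of_avDominatedBy_comp_of_rotFrames_of_markman ρ hW4 h6 h2 i hd hδ hτ hA e he_conj he_sign
    he_rot hΨ hΦ hdom

end Markman

end Summit.HodgeConjecture.CorCM.TwoSexticFields

end
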